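import Mathlib
import HarnessLib
import Summits.NavierStokesRegularity.NavierStokesRegularity.Theorems.SqueezeCycleExtremalElementExistsRegularity
import Summits.NavierStokesRegularity.NavierStokesRegularity.Theorems.PoloidalWindowDoorPoloidalWindowRigidityWindow
import Literature.Analysis.FluidPDE.KNSSWindowLipschitz
import Literature.Analysis.FluidPDE.BarkerPrange2020VorticityAlignmentTypeIHolds

/-!
# Item `LrcModEntire` (stmt-NavierStokesRegularity-20428) — (Q4) entrance wiring: the CLASS CONSTANTS near the slice `t = −1`, UNIFORM over the Type-I class,
# in the currency of the signed vertical component `F τ = σ·u₂(−1+τ, ·)`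

ns-k2-port-2 g6 (helper prover under the LEAD of item 20428, ns-poloidal-K2-p3 g15; `--supports stmt-NavierStokesRegularity-20428 --as helper`).
The (Q3∞)→(Q4) entrance of the «ridge quasiconvexity» lever (memo `Cruxes/LrcModEntire/T2B-g14.md` §13b/§14; port-2 g5's `…RidgeHullValues`,
`…RidgeUniformLateral`, `…RidgeConcavityTube`, `…RidgeWebFermat`) consumes, AT THE HULL LIMIT `U`, four constants: a bound `A` on `D²(σU₂(−1+τ,·))` and the KNSS
slice bound `C₃` on `D³(σU₂(−1+τ,·))` in a time window, the temporal modulus `C_t` of `σU₂` and the temporal modulus of `D²(σU₂)` near `τ = 0`.  All four are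
CLASS facts, and — the point of this file — they can be chosen UNIFORMLY over all continuous Type-I Oseen-mild ancient fields with the same Type-I constant `C`
(KNSS 2009 §4, (4.10)–(4.11), in the tree as route `SqueezeCycle`'s `exists_norm_iteratedFDeriv_le_of_typeI` / `exists_lipschitz_time_of_typeI`), so that the SAME tube
radius and window serve a profile `v` and every hull limit `U` of `v` (which has the same constant `C`, `…HotHullCompactness.hullLimit`).

* `exists_classConstants` — for every `C`: constants `K₂, K₃, L₀, L₂ ≥ 0` such that for every class field `u` (Type-I rate `C`, joint continuity, Oseen-mild, divergence-free
  slices) and all `|τ| ≤ 1/4`: `‖D²u(−1+τ)‖ ≤ K₂`, `‖D³u(−1+τ)‖ ≤ K₃`, `‖u(−1+τ,x) − u(−1,x)‖ ≤ L₀|τ|`, `‖D²u(−1+τ)(x) − D²u(−1)(x)‖ ≤ L₂|τ|` (window `[−5/4, −1/2)`);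
* `fderiv_fderiv_signed_eq`, `abs_fderiv_fderiv_signed_sub_le`, `abs_signed_sub_le`, `norm_iteratedFDeriv_signed_le'` — bookkeeping between the jets of the field
  and the nested `fderiv`s of the signed component `y ↦ σ·u(y)₂`, `σ = ±1`;
* `contDiff_signed_slice`, `contDiffOn_uncurry_signed` — the signed slices are `C^n`, and `(τ, y) ↦ σ·u₂(−1+τ, y)` is jointly `C^n` on `(−1/2, 1/2) × ℝ³` (joint
  analyticity of the class, `…PoloidalWindowRigidityWindow.isTypeIAncientMild_of_class`);
* `exists_signedClassConstants` — the four constants in the signed currency: for all class `u`, all `σ = ±1`, all `|τ| ≤ 1/4`: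
  `‖D²(σu₂(−1+τ))‖ ≤ K₂`, `‖D³(σu₂(−1+τ))‖ ≤ K₃`, `|σu₂(−1+τ,y) − σu₂(−1,y)| ≤ L₀|τ|`, `|D²(σu₂(−1+τ))(y)[a,b] − D²(σu₂(−1))(y)[a,b]| ≤ L₂|τ|‖a‖‖b‖` — the
  `A`/`C₃`/`C_t` inputs of `…RidgeUniformLateral.exists_uniform_lateralLevel` and the `C₃`/`C_t` inputs of `…RidgeConcavityTube.hessian_neg_on_tube`, by name.

WHAT THIS IS NOT: not a claim about Navier–Stokes regularity — regularity bookkeeping for hypothetical blow-up profiles feeding the entrance of the research cell (Q4)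
«HOMOGENEOUS NULL RIDGE» (bears_on LADDER-NS N0, item 20428 / crux 19708; 20428/19708/27893 OPEN; (Q4) OPEN).  No summit statement is proved here.
-/

noncomputable section

-- the summit and its single sub-problem share the name (CONVENTIONS §1), as in every Theorems file
set_option linter.dupNamespace false

namespace Summit.NavierStokesRegularity.NavierStokesRegularity.Theorems.PoloidalWindowDoorLrcModEntireRidgeClassConstants

open Set Filter Topology Metric Function
open scoped ContDiff
open Literature.Analysis Literature.Analysis.FluidPDE
open Summit.NavierStokesRegularity.NavierStokesRegularity.Theorems
open Summit.NavierStokesRegularity.NavierStokesRegularity.Theorems.PoloidalWindowDoorPoloidalWindowRigidityWindow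

/-! ### Jets of the field vs. nested `fderiv`s of the signed component -/

/-- The signed vertical component is the composition of the field with the continuous linear functional `σ • proj₂`. -/
theorem signed_eq_comp (u : EuclideanSpace ℝ (Fin 3) → EuclideanSpace ℝ (Fin 3)) (σ : ℝ) :
    (fun y => σ * u y 2) = ⇑(σ • EuclideanSpace.proj (𝕜 := ℝ) (2 : Fin 3)) ∘ u := by
  funext y; simp

/-- **Nested second derivative of the signed component = signed coordinate of the second jet**: for `u` of class `C²` at `y`,
`D²(σu₂)(y)[a,b] = σ·(D²u(y)[a,b])₂`. [folklore] -/
theorem fderiv_fderiv_signed_eq {u : EuclideanSpace ℝ (Fin 3) → EuclideanSpace ℝ (Fin 3)} {y : EuclideanSpace ℝ (Fin 3)}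
    (hu : ContDiffAt ℝ 2 u y) (σ : ℝ) (a b : EuclideanSpace ℝ (Fin 3)) :
    fderiv ℝ (fderiv ℝ (fun y => σ * u y 2)) y a b = σ * (iteratedFDeriv ℝ 2 u y ![a, b]) 2 := by
  have h := iteratedFDeriv_two_apply (𝕜 := ℝ) (fun y => σ * u y 2) y ![a, b]
  simp only [Matrix.cons_val_zero, Matrix.cons_val_one] at h
  rw [← h, signed_eq_comp u σ, ContinuousLinearMap.iteratedFDeriv_comp_left _ hu le_rfl]
  simp

/-- **Temporal/spatial differences of `D²(σu₂)` are controlled by the jets of the field**: for `u, w` of class `C²` at `y` and `σ = ±1`,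
`|D²(σu₂)(y)[a,b] − D²(σw₂)(y)[a,b]| ≤ ‖D²u(y) − D²w(y)‖·‖a‖·‖b‖`. [folklore] -/
theorem abs_fderiv_fderiv_signed_sub_le {u w : EuclideanSpace ℝ (Fin 3) → EuclideanSpace ℝ (Fin 3)} {y : EuclideanSpace ℝ (Fin 3)}
    (hu : ContDiffAt ℝ 2 u y) (hw : ContDiffAt ℝ 2 w y) {σ : ℝ} (hσ : σ = 1 ∨ σ = -1) (a b : EuclideanSpace ℝ (Fin 3)) :
    |fderiv ℝ (fderiv ℝ (fun y => σ * u y 2)) y a b - fderiv ℝ (fderiv ℝ (fun y => σ * w y 2)) y a b| ≤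
      ‖iteratedFDeriv ℝ 2 u y - iteratedFDeriv ℝ 2 w y‖ * ‖a‖ * ‖b‖ := by
  rw [fderiv_fderiv_signed_eq hu, fderiv_fderiv_signed_eq hw, ← mul_sub]
  have hσ1 : |σ| = 1 := by rcases hσ with h | h <;> simp [h]
  rw [abs_mul, hσ1, one_mul]
  have hcoord : |(iteratedFDeriv ℝ 2 u y ![a, b]) 2 - (iteratedFDeriv ℝ 2 w y ![a, b]) 2| ≤
      ‖(iteratedFDeriv ℝ 2 u y - iteratedFDeriv ℝ 2 w y) ![a, b]‖ := by
    have h := PiLp.norm_apply_le ((iteratedFDeriv ℝ 2 u y - iteratedFDeriv ℝ 2 w y) ![a, b]) (2 : Fin 3)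
    simpa using h
  refine hcoord.trans ?_
  have hle := (iteratedFDeriv ℝ 2 u y - iteratedFDeriv ℝ 2 w y).le_opNorm ![a, b]
  rw [Fin.prod_univ_two] at hle
  simpa [mul_assoc] using hle

/-- `|σu₂(y) − σw₂(y)| ≤ ‖u(y) − w(y)‖` for `σ = ±1`. [folklore] -/
theorem abs_signed_sub_le (u w : EuclideanSpace ℝ (Fin 3) → EuclideanSpace ℝ (Fin 3)) {σ : ℝ} (hσ : σ = 1 ∨ σ = -1)
    (y : EuclideanSpace ℝ (Fin 3)) : |σ * u y 2 - σ * w y 2| ≤ ‖u y - w y‖ := by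
  have hσ1 : |σ| = 1 := by rcases hσ with h | h <;> simp [h]
  rw [← mul_sub, abs_mul, hσ1, one_mul]
  have h := PiLp.norm_apply_le (u y - w y) (2 : Fin 3)
  simpa using h

/-- The jet norms of the signed component are bounded by those of the field (`σ = ±1`; smoothness `C^n`, `k ≤ n`). -/
theorem norm_iteratedFDeriv_signed_le' {u : EuclideanSpace ℝ (Fin 3) → EuclideanSpace ℝ (Fin 3)} {n : WithTop ℕ∞} (hu : ContDiff ℝ n u)
    {σ : ℝ} (hσ : σ = 1 ∨ σ = -1) {k : ℕ} (hk : (k : WithTop ℕ∞) ≤ n) (w : EuclideanSpace ℝ (Fin 3)) :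
    ‖iteratedFDeriv ℝ k (fun y => σ * u y 2) w‖ ≤ ‖iteratedFDeriv ℝ k u w‖ := by
  rw [signed_eq_comp u σ, ContinuousLinearMap.iteratedFDeriv_comp_left _ hu.contDiffAt hk]
  refine (ContinuousLinearMap.norm_compContinuousMultilinearMap_le _ _).trans ?_
  have hproj : ‖σ • (EuclideanSpace.proj (𝕜 := ℝ) (2 : Fin 3) : EuclideanSpace ℝ (Fin 3) →L[ℝ] ℝ)‖ ≤ 1 := by
    refine ContinuousLinearMap.opNorm_le_bound _ zero_le_one fun y => ?_
    have hσ1 : |σ| = 1 := by rcases hσ with h | h <;> simp [h]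
    have h := PiLp.norm_apply_le y (2 : Fin 3)
    simpa [hσ1] using h
  calc ‖σ • (EuclideanSpace.proj (𝕜 := ℝ) (2 : Fin 3) : EuclideanSpace ℝ (Fin 3) →L[ℝ] ℝ)‖ * ‖iteratedFDeriv ℝ k u w‖
      ≤ 1 * ‖iteratedFDeriv ℝ k u w‖ := mul_le_mul_of_nonneg_right hproj (norm_nonneg _)
    _ = ‖iteratedFDeriv ℝ k u w‖ := one_mul _

/-! ### Smoothness of the signed slices and of the signed space–time component (class) -/

variable {C : ℝ} {u : ℝ → EuclideanSpace ℝ (Fin 3) → EuclideanSpace ℝ (Fin 3)}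

/-- The slices of a class field are smooth. -/
theorem contDiff_slice_of_class (hrate : HasTypeITimeDecay C u) (hcont : ContinuousOn (uncurry u) (Iio (0 : ℝ) ×ˢ univ))
    (hmild : ∀ s t : ℝ, s < t → t < 0 → ∀ x, u t x = UnboundedOperators.heatExtension (u s) (t - s) x - oseenDuhamel 1 s u u t x)
    (hdiv : ∀ t < 0, VectorCalculus.IsDivFree (u t)) {t : ℝ} (ht : t < 0) {n : WithTop ℕ∞} : ContDiff ℝ n (u t) :=
  (IsTypeIAncientMild.analyticOnNhd_slice_univ
    (PoloidalWindowDoorPoloidalWindowRigidityWindow.isTypeIAncientMild_of_class hrate hcont hmild hdiv) ht).contDiff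

/-- The signed vertical component of a slice of a class field is smooth. -/
theorem contDiff_signed_slice (hrate : HasTypeITimeDecay C u) (hcont : ContinuousOn (uncurry u) (Iio (0 : ℝ) ×ˢ univ))
    (hmild : ∀ s t : ℝ, s < t → t < 0 → ∀ x, u t x = UnboundedOperators.heatExtension (u s) (t - s) x - oseenDuhamel 1 s u u t x)
    (hdiv : ∀ t < 0, VectorCalculus.IsDivFree (u t)) {t : ℝ} (ht : t < 0) (σ : ℝ) {n : WithTop ℕ∞} :
    ContDiff ℝ n (fun y => σ * u t y 2) := by
  rw [signed_eq_comp (u t) σ]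
  exact (ContinuousLinearMap.contDiff _).comp (contDiff_slice_of_class hrate hcont hmild hdiv ht)

/-- The slices of a class field are weakly divergence free (classical ⇒ weak for `C¹` slices). -/
theorem isWeaklyDivFree_of_class (hrate : HasTypeITimeDecay C u) (hcont : ContinuousOn (uncurry u) (Iio (0 : ℝ) ×ˢ univ))
    (hmild : ∀ s t : ℝ, s < t → t < 0 → ∀ x, u t x = UnboundedOperators.heatExtension (u s) (t - s) x - oseenDuhamel 1 s u u t x)
    (hdiv : ∀ t < 0, VectorCalculus.IsDivFree (u t)) : ∀ t < 0, IsWeaklyDivFree (u t) := fun t ht =>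
  VectorCalculus.IsDivFree.isWeaklyDivFree_holds (hdiv t ht) (contDiff_slice_of_class hrate hcont hmild hdiv ht)

/-- **The signed space–time component `(τ, y) ↦ σ·u₂(−1+τ, y)` is jointly `C^n` on `(−1/2, 1/2) × ℝ³`** (joint analyticity of the class on the open slab,
`isTypeIAncientMild_of_class`, composed with the time shift and `σ • proj₂`) — the `hF` input of `…RidgeWebFermat.web_fermat` with `T = (−1/2, 1/2)` or any
open sub-interval. -/
theorem contDiffOn_uncurry_signed (hrate : HasTypeITimeDecay C u) (hcont : ContinuousOn (uncurry u) (Iio (0 : ℝ) ×ˢ univ))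
    (hmild : ∀ s t : ℝ, s < t → t < 0 → ∀ x, u t x = UnboundedOperators.heatExtension (u s) (t - s) x - oseenDuhamel 1 s u u t x)
    (hdiv : ∀ t < 0, VectorCalculus.IsDivFree (u t)) (σ : ℝ) {n : ℕ∞} {T : Set ℝ} (hT : T ⊆ Ioo (-1 / 2) (1 / 2)) :
    ContDiffOn ℝ n (uncurry fun τ y => σ * u (-1 + τ) y 2) (T ×ˢ (univ : Set (EuclideanSpace ℝ (Fin 3)))) := by
  have hslab : ContDiffOn ℝ ∞ (uncurry u) (Iio (0 : ℝ) ×ˢ univ) :=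
    (PoloidalWindowDoorPoloidalWindowRigidityWindow.isTypeIAncientMild_of_class hrate hcont hmild hdiv).1
  have hshift : ContDiff ℝ ∞ fun p : ℝ × EuclideanSpace ℝ (Fin 3) => ((-1 + p.1, p.2) : ℝ × EuclideanSpace ℝ (Fin 3)) :=
    (contDiff_const.add contDiff_fst).prodMk contDiff_snd
  have hmaps : MapsTo (fun p : ℝ × EuclideanSpace ℝ (Fin 3) => ((-1 + p.1, p.2) : ℝ × EuclideanSpace ℝ (Fin 3)))
      (T ×ˢ (univ : Set (EuclideanSpace ℝ (Fin 3)))) (Iio (0 : ℝ) ×ˢ univ) := by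
    intro p hp
    exact ⟨show -1 + p.1 < 0 by have := (hT hp.1).2; linarith, mem_univ _⟩
  have hcomp : ContDiffOn ℝ ∞ (uncurry u ∘ fun p : ℝ × EuclideanSpace ℝ (Fin 3) => ((-1 + p.1, p.2) : ℝ × EuclideanSpace ℝ (Fin 3)))
      (T ×ˢ (univ : Set (EuclideanSpace ℝ (Fin 3)))) := hslab.comp hshift.contDiffOn hmaps
  have hfull : ContDiffOn ℝ ∞ (⇑(σ • EuclideanSpace.proj (𝕜 := ℝ) (2 : Fin 3)) ∘ (uncurry u ∘
      fun p : ℝ × EuclideanSpace ℝ (Fin 3) => ((-1 + p.1, p.2) : ℝ × EuclideanSpace ℝ (Fin 3)))) (T ×ˢ (univ : Set (EuclideanSpace ℝ (Fin 3)))) :=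
    (ContinuousLinearMap.contDiff _).comp_contDiffOn hcomp
  have e : (uncurry fun τ y => σ * u (-1 + τ) y 2) = ⇑(σ • EuclideanSpace.proj (𝕜 := ℝ) (2 : Fin 3)) ∘ (uncurry u ∘
      fun p : ℝ × EuclideanSpace ℝ (Fin 3) => ((-1 + p.1, p.2) : ℝ × EuclideanSpace ℝ (Fin 3))) := by
    funext p; simp [uncurry]
  rw [e]
  exact hfull.of_le (by exact WithTop.coe_le_coe.2 le_top)

/-! ### The four class constants, uniform over the class -/

/-- **THE FOUR CLASS CONSTANTS NEAR THE SLICE `t = −1`, UNIFORM OVER THE CLASS** (KNSS 2009 §4 (4.10)–(4.11) through route `SqueezeCycle`'s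
`exists_norm_iteratedFDeriv_le_of_typeI` / `exists_lipschitz_time_of_typeI` on the window `[−5/4, −1/2)`): for every Type-I constant `C` there are `K₂, K₃, L₀, L₂ ≥ 0`
such that every continuous Type-I Oseen-mild ancient field `u` with constant `C` and divergence-free slices satisfies, for all `|τ| ≤ 1/4` and all `x`:
`‖D²u(−1+τ)(x)‖ ≤ K₂`, `‖D³u(−1+τ)(x)‖ ≤ K₃`, `‖u(−1+τ,x) − u(−1,x)‖ ≤ L₀|τ|`, `‖D²u(−1+τ)(x) − D²u(−1)(x)‖ ≤ L₂|τ|`.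
[cite: KochNadirashviliSereginSverak2009, §4 Prop. 4.1 with (4.10)–(4.11) (arXiv:0709.3599v1 p. 8)] -/
theorem exists_classConstants (C : ℝ) :
    ∃ K₂ K₃ L₀ L₂ : ℝ, 0 ≤ K₂ ∧ 0 ≤ K₃ ∧ 0 ≤ L₀ ∧ 0 ≤ L₂ ∧
      ∀ ⦃u : ℝ → EuclideanSpace ℝ (Fin 3) → EuclideanSpace ℝ (Fin 3)⦄,
        HasTypeITimeDecay C u → ContinuousOn (uncurry u) (Iio (0 : ℝ) ×ˢ univ) →
        (∀ s t : ℝ, s < t → t < 0 → ∀ x, u t x = UnboundedOperators.heatExtension (u s) (t - s) x - oseenDuhamel 1 s u u t x) →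
        (∀ t < 0, VectorCalculus.IsDivFree (u t)) →
        (∀ τ : ℝ, |τ| ≤ 1 / 4 → ∀ x, ‖iteratedFDeriv ℝ 2 (u (-1 + τ)) x‖ ≤ K₂) ∧
        (∀ τ : ℝ, |τ| ≤ 1 / 4 → ∀ x, ‖iteratedFDeriv ℝ 3 (u (-1 + τ)) x‖ ≤ K₃) ∧
        (∀ τ : ℝ, |τ| ≤ 1 / 4 → ∀ x, ‖u (-1 + τ) x - u (-1) x‖ ≤ L₀ * |τ|) ∧
        (∀ τ : ℝ, |τ| ≤ 1 / 4 → ∀ x, ‖iteratedFDeriv ℝ 2 (u (-1 + τ)) x - iteratedFDeriv ℝ 2 (u (-1)) x‖ ≤ L₂ * |τ|) := by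
  -- the window `[a + δ, b) = [−5/4, −1/2)`, `a = −3/2`, `δ = 1/4`
  have hab : (-3 / 2 : ℝ) < -1 / 2 := by norm_num
  have hb : (-1 / 2 : ℝ) < 0 := by norm_num
  have hδ : (0 : ℝ) < 1 / 4 := by norm_num
  obtain ⟨K₂, hK₂⟩ := exists_norm_iteratedFDeriv_le_of_typeI C 2 hab hb hδ
  obtain ⟨K₃, hK₃⟩ := exists_norm_iteratedFDeriv_le_of_typeI C 3 hab hb hδ
  obtain ⟨L₀, hL₀0, hL₀⟩ := exists_lipschitz_time_of_typeI C 0 hab hb hδ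
  obtain ⟨L₂, hL₂0, hL₂⟩ := exists_lipschitz_time_of_typeI C 2 hab hb hδ
  have hwin : ∀ τ : ℝ, |τ| ≤ 1 / 4 → -1 + τ ∈ Ico (-3 / 2 + 1 / 4 : ℝ) (-1 / 2) := fun τ hτ =>
    ⟨by linarith [(abs_le.1 hτ).1], by linarith [(abs_le.1 hτ).2]⟩
  have h0win : (-1 : ℝ) ∈ Ico (-3 / 2 + 1 / 4 : ℝ) (-1 / 2) := ⟨by norm_num, by norm_num⟩
  refine ⟨max K₂ 0, max K₃ 0, L₀, L₂, le_max_right _ _, le_max_right _ _, hL₀0, hL₂0, fun u hrate hcont hmild hdiv => ?_⟩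
  have hwdiv := isWeaklyDivFree_of_class hrate hcont hmild hdiv
  refine ⟨fun τ hτ x => (hK₂ hcont hwdiv hmild hrate _ (hwin τ hτ) x).trans (le_max_left _ _),
    fun τ hτ x => (hK₃ hcont hwdiv hmild hrate _ (hwin τ hτ) x).trans (le_max_left _ _),
    fun τ hτ x => ?_, fun τ hτ x => ?_⟩
  · have h := hL₀ hcont hwdiv hmild hrate (-1) h0win (-1 + τ) (hwin τ hτ) x
    rwa [norm_iteratedFDeriv_zero_sub, show (-1 + τ - -1 : ℝ) = τ by ring] at h
  · have h := hL₂ hcont hwdiv hmild hrate (-1) h0win (-1 + τ) (hwin τ hτ) x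
    rwa [show (-1 + τ - -1 : ℝ) = τ by ring] at h

/-- **THE FOUR CLASS CONSTANTS IN THE SIGNED CURRENCY** `F τ = σ·u₂(−1+τ, ·)`, `σ = ±1`, uniform over the class with Type-I constant `C`: for all `|τ| ≤ 1/4`,
`‖D³u(−1+τ)‖ ≤ K₃` (vector form, the `hC₃` of `…RidgeHullValues`), `‖D²(F τ)‖ ≤ K₂`, `‖D³(F τ)‖ ≤ K₃` (the `A` / `C₃` of `…RidgeUniformLateral` and
`…RidgeConcavityTube`), `|F τ y − F 0 y| ≤ L₀|τ|` (the `C_t` of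
`…RidgeUniformLateral`), and `|D²(F τ)(y)[a,b] − D²(F 0)(y)[a,b]| ≤ L₂|τ|‖a‖‖b‖` (the temporal modulus of `…RidgeConcavityTube.hessian_neg_on_tube`).
[cite: KochNadirashviliSereginSverak2009, §4 Prop. 4.1 with (4.10)–(4.11) (arXiv:0709.3599v1 p. 8)] -/
theorem exists_signedClassConstants (C : ℝ) :
    ∃ K₂ K₃ L₀ L₂ : ℝ, 0 ≤ K₂ ∧ 0 ≤ K₃ ∧ 0 ≤ L₀ ∧ 0 ≤ L₂ ∧
      ∀ ⦃u : ℝ → EuclideanSpace ℝ (Fin 3) → EuclideanSpace ℝ (Fin 3)⦄,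
        HasTypeITimeDecay C u → ContinuousOn (uncurry u) (Iio (0 : ℝ) ×ˢ univ) →
        (∀ s t : ℝ, s < t → t < 0 → ∀ x, u t x = UnboundedOperators.heatExtension (u s) (t - s) x - oseenDuhamel 1 s u u t x) →
        (∀ t < 0, VectorCalculus.IsDivFree (u t)) →
        ∀ ⦃σ : ℝ⦄, (σ = 1 ∨ σ = -1) →
          (∀ τ : ℝ, |τ| ≤ 1 / 4 → ∀ x, ‖iteratedFDeriv ℝ 3 (u (-1 + τ)) x‖ ≤ K₃) ∧
          (∀ τ : ℝ, |τ| ≤ 1 / 4 → ∀ x, ‖iteratedFDeriv ℝ 2 (fun y => σ * u (-1 + τ) y 2) x‖ ≤ K₂) ∧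
          (∀ τ : ℝ, |τ| ≤ 1 / 4 → ∀ x, ‖iteratedFDeriv ℝ 3 (fun y => σ * u (-1 + τ) y 2) x‖ ≤ K₃) ∧
          (∀ τ : ℝ, |τ| ≤ 1 / 4 → ∀ y, |σ * u (-1 + τ) y 2 - σ * u (-1) y 2| ≤ L₀ * |τ|) ∧
          (∀ τ : ℝ, |τ| ≤ 1 / 4 → ∀ y a b,
            |fderiv ℝ (fderiv ℝ (fun y => σ * u (-1 + τ) y 2)) y a b - fderiv ℝ (fderiv ℝ (fun y => σ * u (-1) y 2)) y a b| ≤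
              L₂ * |τ| * ‖a‖ * ‖b‖) := by
  obtain ⟨K₂, K₃, L₀, L₂, hK₂0, hK₃0, hL₀0, hL₂0, hcl⟩ := exists_classConstants C
  refine ⟨K₂, K₃, L₀, L₂, hK₂0, hK₃0, hL₀0, hL₂0, fun u hrate hcont hmild hdiv σ hσ => ?_⟩
  obtain ⟨h2, h3, h0, h22⟩ := hcl hrate hcont hmild hdiv
  have hneg : ∀ τ : ℝ, |τ| ≤ 1 / 4 → -1 + τ < 0 := fun τ hτ => by linarith [(abs_le.1 hτ).2]
  have hsl : ∀ τ : ℝ, |τ| ≤ 1 / 4 → ContDiff ℝ ∞ (u (-1 + τ)) := fun τ hτ => contDiff_slice_of_class hrate hcont hmild hdiv (hneg τ hτ)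
  have hsl0 : ContDiff ℝ ∞ (u (-1)) := contDiff_slice_of_class hrate hcont hmild hdiv (by norm_num)
  refine ⟨h3, fun τ hτ x => (norm_iteratedFDeriv_signed_le' (hsl τ hτ) hσ (by exact WithTop.coe_le_coe.2 le_top) x).trans (h2 τ hτ x),
    fun τ hτ x => (norm_iteratedFDeriv_signed_le' (hsl τ hτ) hσ (by exact WithTop.coe_le_coe.2 le_top) x).trans (h3 τ hτ x),
    fun τ hτ y => (abs_signed_sub_le _ _ hσ y).trans (h0 τ hτ y), fun τ hτ y a b => ?_⟩
  have hu2 : ContDiffAt ℝ 2 (u (-1 + τ)) y := ((hsl τ hτ).of_le (by exact WithTop.coe_le_coe.2 le_top)).contDiffAt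
  have hw2 : ContDiffAt ℝ 2 (u (-1)) y := (hsl0.of_le (by exact WithTop.coe_le_coe.2 le_top)).contDiffAt
  refine (abs_fderiv_fderiv_signed_sub_le hu2 hw2 hσ a b).trans ?_
  have h := h22 τ hτ y
  have := mul_le_mul_of_nonneg_right (mul_le_mul_of_nonneg_right h (norm_nonneg a)) (norm_nonneg b)
  simpa [mul_assoc] using this

end Summit.NavierStokesRegularity.NavierStokesRegularity.Theorems.PoloidalWindowDoorLrcModEntireRidgeClassConstants

end
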